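import Summits.QuantumFields.YangMills.Theorems.UnitScaleTiltProp7SymFrameGaugeResponseAt
import Summits.QuantumFields.YangMills.Theorems.UnitScaleTiltProp7AxialGaugeFace
import Literature.MathematicalPhysics.QuantumFieldTheory.Balaban1983to89.BlockAveragingEMLLinearised
import HarnessLib

/-!
# Route `UnitScaleTilt`, crux K1 child «MinimiserStabilityRegPr» (stmt-QuantumFields-19200), skeleton v10, stub `stub_existenceMinimalOrbit` (EX), route (α) — **ONTO-NESS OF THE
# FRAME-CORRECTED GAUGE OPERATOR `𝓚_{A₁}`, LEVEL BY LEVEL AND DOWN THE TOWER** (the located residue (P1) of `hSplitD`, LOCATE memo v2 `LOCATE-TRANSPORT-ONTO-w5g6.md` §3, items 1–4 of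
# its shopping list): at each level the map on BLOCK-CONSTANT parameters is `1 + O(δ)` on the value algebra, hence onto by Neumann; top-down over the levels this produces, for every
# target `m` at the top level, a fine gauge parameter `N` whose frame-corrected response `N∘x̂⁽ᵏ⁾ − V_k ν_k⁻¹` IS `m`.

Cell `ym3-torus`, width seat `ym-ust-20520-w5` (gen 6).  THEOREMS ONLY (0 `def`, 0 `sorry`).  `--supports stmt-QuantumFields-19200 --as helper`, count-neutral.  YM₃ on T³ is a ladder rung (R3), not
the Clay problem; nothing here claims the stub, the crux, d = 4 or the mass gap.

THE POINT.  FR₁ (✓`Prop7SymFrameGaugeResponseAt`) gives the response of the accumulated frames along `U′^{g_t}` against `U₀` as a recursion whose level step is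
`V_{j+1}(y) = V_j(ŷ)w_j(y) + ν_j(ŷ)·D eml(τ_j(y))(i ↦ (ω(ŷ) − Ad_{D̄_j(Γ_{y,i})} ω(x_i))·τ_i)`, `ω = Ad_{ν_j⁻¹}(N∘x̂⁽ʲ⁾ − V_jν_j⁻¹)`.  For a COVARIANTLY BLOCK-CONSTANT frame-corrected
quantity `ρ_j(x) = Ad_{Q_{y,i₀(x)}⁻¹Q_{y,i₀(ŷ)}} c(y)` (`Q_{y,i}` the `Ū′⁽ʲ⁾`-transport along the stair `i` from the centre, `i₀(x)` the reference stair to `x`) the next one is, site by site,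
the value map `L_{j,y}(c(y))` of §2 with the LOOP holonomies `H_{y,i} = Q_{y,i}Q_{y,i₀(x_i)}⁻¹Q_{y,i₀(ŷ)}` as conjugating units, and `L_{j,y} = mean_i Ad_{H_i} + O(δ)` is within `11/20` of the
identity when `‖τ_j − 1‖, ‖H^{±1} − 1‖ ≤ δ ≤ 1/200` — a GAUGE-INVARIANT closeness (relative transporters and loop holonomies inside one block), small for regular towers.  So every target at the top is reached (§3), with no summation over levels (each preimage is chosen independently).
Consumed by the member file (T4's solvability hypothesis `hK`, ✓`Prop7TwistedSliceGaugeOnto`, via the GLUE ✓`Prop7FrameResponseChartGlue`).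

WHAT IS PROVED (sorry-free, no definition, any complete normed `ℂ`-algebra `𝔸` with `‖1‖ = 1`): §1 `mul_meanCLM_mul`, `norm_conj_sub_self_le`; §2 ★★★`exists_levelMap_eq`; §3 `blockOf_transl_emb_disp_stairWord`, `blockSite_blockOf_offs`,
`offs_blockSite`, `offs_emb`, `transl_emb_disp_stairWord_eq_blockSite`, ★★★`exists_frameCorrected_eq`.
HONEST SCOPE: the tower closeness (`δ ≤ 1/200` on the relative transporters `τ_j` and on the loop holonomies `H_{j,y,i}^{±1}`, and the bounds `2` on `ν_j^{±1}`, `w_j⁻¹`) is a displayed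
HYPOTHESIS at every level (for printed-regular pairs: ✓`norm_dbarCovIterU_rel_sub_one_le_of_regPr` + ✓`norm_tstairU_sub_one_le_of_rel` for `τ`, unitarity for the norms, plaquette
regularity of `Ū′⁽ʲ⁾` for the loops — not derived here); constants are explicit and crude; nothing of print is asserted.

References: T. Bałaban, CMP 98 (1985) 17–51 [Balaban1985Averaging] ((82) p.30, (89)–(92) p.31, (97) p.32); CMP 99 (1985) 389–434 [Balaban1985BackgroundPropagators] ((3.19) p.393,
(3.21) p.394, (3.114)–(3.115) p.418); CMP 109 (1987) 249–301 [Balaban1987RG1] ((0.3)–(0.4) pp.252–253).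
-/

set_option autoImplicit false

noncomputable section

open scoped BigOperators Topology
open Filter NormedSpace Metric

namespace Summit.QuantumFields.YangMills.Theorems.Prop7FrameLevelOnto

open Literature.MathematicalPhysics.QuantumFieldTheory.Balaban1983to89
open T4Continuum BlockAveraging ExpMeanLog MatrixLog
open BlockAveragingEMLAnalyticMean (norm_fderiv_eml_sub_mean_le norm_eml_add_sub_eml_le eml_one)
open B7TransferAnalyticMean (meanCLM meanCLM_apply norm_meanCLM_apply_le)
open Summit.QuantumFields.YangMills.Theorems.Prop7SymFrameGaugeResponseAt (norm_fderiv_eml_mul_sub_mean_mul_le surjective_of_norm_sub_smul_one_lt hasDerivAt_frameAccU_succ_at)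

variable {ι : Type*} [Fintype ι] {𝔸 : Type*} [NormedRing 𝔸] [NormedAlgebra ℂ 𝔸] [CompleteSpace 𝔸]

/-! ## §1–§2 The level map on block-constant values is onto -/

omit [CompleteSpace 𝔸] in
/-- conjugation moved inside the arithmetic mean: `a·(mean f)·b = mean (i ↦ a·f i·b)`. [folklore] -/
theorem mul_meanCLM_mul (a b : 𝔸) (f : ι → 𝔸) : a * meanCLM ι 𝔸 f * b = meanCLM ι 𝔸 fun i => a * f i * b := by
  rw [meanCLM_apply, meanCLM_apply, mul_smul_comm, smul_mul_assoc, Finset.mul_sum, Finset.sum_mul]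

variable [NormOneClass 𝔸]

omit [NormedAlgebra ℂ 𝔸] [CompleteSpace 𝔸] in
/-- `‖Q c Q⁻¹ − c‖ ≤ (‖Q − 1‖(1 + ‖Q⁻¹ − 1‖) + ‖Q⁻¹ − 1‖)·‖c‖` — conjugation by a unit near `1` moves little. [folklore] -/
theorem norm_conj_sub_self_le (Q : 𝔸ˣ) (c : 𝔸) :
    ‖(Q : 𝔸) * c * ((Q⁻¹ : 𝔸ˣ) : 𝔸) - c‖ ≤ (‖(Q : 𝔸) - 1‖ * (1 + ‖((Q⁻¹ : 𝔸ˣ) : 𝔸) - 1‖) + ‖((Q⁻¹ : 𝔸ˣ) : 𝔸) - 1‖) * ‖c‖ := by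
  have heq : (Q : 𝔸) * c * ((Q⁻¹ : 𝔸ˣ) : 𝔸) - c = ((Q : 𝔸) - 1) * c * ((Q⁻¹ : 𝔸ˣ) : 𝔸) + c * (((Q⁻¹ : 𝔸ˣ) : 𝔸) - 1) := by
    noncomm_ring
  rw [heq]
  have hQi : ‖((Q⁻¹ : 𝔸ˣ) : 𝔸)‖ ≤ 1 + ‖((Q⁻¹ : 𝔸ˣ) : 𝔸) - 1‖ := by
    calc ‖((Q⁻¹ : 𝔸ˣ) : 𝔸)‖ = ‖1 + (((Q⁻¹ : 𝔸ˣ) : 𝔸) - 1)‖ := by rw [add_sub_cancel]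
      _ ≤ ‖(1 : 𝔸)‖ + ‖((Q⁻¹ : 𝔸ˣ) : 𝔸) - 1‖ := norm_add_le _ _
      _ = 1 + ‖((Q⁻¹ : 𝔸ˣ) : 𝔸) - 1‖ := by rw [norm_one]
  calc ‖((Q : 𝔸) - 1) * c * ((Q⁻¹ : 𝔸ˣ) : 𝔸) + c * (((Q⁻¹ : 𝔸ˣ) : 𝔸) - 1)‖
      ≤ ‖((Q : 𝔸) - 1) * c * ((Q⁻¹ : 𝔸ˣ) : 𝔸)‖ + ‖c * (((Q⁻¹ : 𝔸ˣ) : 𝔸) - 1)‖ := norm_add_le _ _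
    _ ≤ ‖(Q : 𝔸) - 1‖ * ‖c‖ * ‖((Q⁻¹ : 𝔸ˣ) : 𝔸)‖ + ‖c‖ * ‖((Q⁻¹ : 𝔸ˣ) : 𝔸) - 1‖ := by
        gcongr
        · exact (norm_mul_le _ _).trans (by gcongr; exact norm_mul_le _ _)
        · exact norm_mul_le _ _
    _ ≤ ‖(Q : 𝔸) - 1‖ * ‖c‖ * (1 + ‖((Q⁻¹ : 𝔸ˣ) : 𝔸) - 1‖) + ‖c‖ * ‖((Q⁻¹ : 𝔸ˣ) : 𝔸) - 1‖ := by gcongr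
    _ = (‖(Q : 𝔸) - 1‖ * (1 + ‖((Q⁻¹ : 𝔸ˣ) : 𝔸) - 1‖) + ‖((Q⁻¹ : 𝔸ˣ) : 𝔸) - 1‖) * ‖c‖ := by ring

/-- ★★★ **THE LEVEL MAP ON (COVARIANTLY) BLOCK-CONSTANT VALUES IS ONTO** (one level of the frame-corrected operator `𝓚_{A₁}`).  With the one-level data at a coarse site `y` —
transporters `τ = (τ_i)` (`‖τ − 1‖ ≤ δ`), frame `ν = ν(ŷ)`, one-level frame `w = eml τ`, and conjugating units `Q_i` (in the tower: the LOOP holonomies `H_{y,i}` of §3) with `‖Q_i^{±1} − 1‖ ≤ δ`,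
`‖ν^{±1}‖, ‖w⁻¹‖ ≤ 2`, `δ ≤ 1/200` — the value map `L(c) = c − ν·D eml(τ)(i ↦ ν⁻¹(c − Q_i c Q_i⁻¹)ν·τ_i)·w⁻¹·ν⁻¹` hits every `m ∈ 𝔸`: `L = mean_i Ad_{Q_i} − Ad_ν(R(σ(·))w⁻¹)` is within
`11/20` of the identity (FR₁ §5: `‖R σ‖ ≤ 163‖σ‖‖τ − 1‖`, `‖σ(c)‖ ≤ 9δ‖c‖`), hence onto (FR₁ §6 Neumann). [cite: Balaban1985Averaging, (82) p.30, (97) p.32; Balaban1985BackgroundPropagators, (3.19) p.393, (3.21) p.394] -/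
theorem exists_levelMap_eq (τ : ι → 𝔸) {δ : ℝ} (hδ0 : 0 ≤ δ) (hδ : δ ≤ 1 / 200) (hτ : ‖τ - 1‖ ≤ δ)
    (ν w : 𝔸ˣ) (hw : (w : 𝔸) = eml τ) (hν : ‖(ν : 𝔸)‖ ≤ 2) (hν' : ‖((ν⁻¹ : 𝔸ˣ) : 𝔸)‖ ≤ 2) (hw' : ‖((w⁻¹ : 𝔸ˣ) : 𝔸)‖ ≤ 2)
    (Q : ι → 𝔸ˣ) (hQ : ∀ i, ‖(Q i : 𝔸) - 1‖ ≤ δ) (hQ' : ∀ i, ‖(((Q i)⁻¹ : 𝔸ˣ) : 𝔸) - 1‖ ≤ δ) (m : 𝔸) :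
    ∃ c : 𝔸, c - (ν : 𝔸) * fderiv ℂ (eml : (ι → 𝔸) → 𝔸) τ
        (fun i => ((ν⁻¹ : 𝔸ˣ) : 𝔸) * (c - (Q i : 𝔸) * c * (((Q i)⁻¹ : 𝔸ˣ) : 𝔸)) * (ν : 𝔸) * τ i) * ((w⁻¹ : 𝔸ˣ) : 𝔸) * ((ν⁻¹ : 𝔸ˣ) : 𝔸) = m := by
  -- the pieces as continuous linear maps
  set σ : 𝔸 → ι → 𝔸 := fun c i => ((ν⁻¹ : 𝔸ˣ) : 𝔸) * (c - (Q i : 𝔸) * c * (((Q i)⁻¹ : 𝔸ˣ) : 𝔸)) * (ν : 𝔸) with hσ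
  set Sg : 𝔸 →L[ℂ] (ι → 𝔸) := ContinuousLinearMap.pi fun i =>
    ContinuousLinearMap.mulLeftRight ℂ 𝔸 ((ν⁻¹ : 𝔸ˣ) : 𝔸) ((ν : 𝔸) * τ i)
      - ContinuousLinearMap.mulLeftRight ℂ 𝔸 (((ν⁻¹ : 𝔸ˣ) : 𝔸) * (Q i : 𝔸)) ((((Q i)⁻¹ : 𝔸ˣ) : 𝔸) * (ν : 𝔸) * τ i) with hSg
  have hSgσ : ∀ c, Sg c = σ c * τ := by
    intro c; funext i
    simp only [hSg, hσ, ContinuousLinearMap.pi_apply, _root_.sub_apply, ContinuousLinearMap.mulLeftRight_apply, Pi.mul_apply]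
    noncomm_ring
  have hSgi : ∀ c i, Sg c i = ((ν⁻¹ : 𝔸ˣ) : 𝔸) * (c - (Q i : 𝔸) * c * (((Q i)⁻¹ : 𝔸ˣ) : 𝔸)) * (ν : 𝔸) * τ i := by
    intro c i; rw [hSgσ]; rfl
  set K : 𝔸 →L[ℂ] 𝔸 := (ContinuousLinearMap.mulLeftRight ℂ 𝔸 (ν : 𝔸) (((w⁻¹ : 𝔸ˣ) : 𝔸) * ((ν⁻¹ : 𝔸ˣ) : 𝔸))).comp
    ((fderiv ℂ (eml : (ι → 𝔸) → 𝔸) τ).comp Sg) with hK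
  have hKapply : ∀ c, K c = (ν : 𝔸) * fderiv ℂ (eml : (ι → 𝔸) → 𝔸) τ
      (fun i => ((ν⁻¹ : 𝔸ˣ) : 𝔸) * (c - (Q i : 𝔸) * c * (((Q i)⁻¹ : 𝔸ˣ) : 𝔸)) * (ν : 𝔸) * τ i) * ((w⁻¹ : 𝔸ˣ) : 𝔸) * ((ν⁻¹ : 𝔸ˣ) : 𝔸) := by
    intro c
    rw [hK, ContinuousLinearMap.comp_apply, ContinuousLinearMap.comp_apply, ContinuousLinearMap.mulLeftRight_apply,
      show Sg c = (fun i => ((ν⁻¹ : 𝔸ˣ) : 𝔸) * (c - (Q i : 𝔸) * c * (((Q i)⁻¹ : 𝔸ˣ) : 𝔸)) * (ν : 𝔸) * τ i) from funext (hSgi c), ← mul_assoc]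
  -- the pointwise bound `‖K c‖ ≤ θ‖c‖`
  have hτ24 : ‖τ - 1‖ ≤ 1 / 24 := hτ.trans (hδ.trans (by norm_num))
  have hσn : ∀ c, ‖σ c‖ ≤ 9 * δ * ‖c‖ := by
    intro c
    refine (pi_norm_le_iff_of_nonneg (by positivity)).2 fun i => ?_
    have h1 : ‖c - (Q i : 𝔸) * c * (((Q i)⁻¹ : 𝔸ˣ) : 𝔸)‖ ≤ (δ * (1 + δ) + δ) * ‖c‖ := by
      rw [norm_sub_rev]
      calc ‖(Q i : 𝔸) * c * (((Q i)⁻¹ : 𝔸ˣ) : 𝔸) - c‖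
          ≤ (‖(Q i : 𝔸) - 1‖ * (1 + ‖(((Q i)⁻¹ : 𝔸ˣ) : 𝔸) - 1‖) + ‖(((Q i)⁻¹ : 𝔸ˣ) : 𝔸) - 1‖) * ‖c‖ := norm_conj_sub_self_le (Q i) c
        _ ≤ (δ * (1 + δ) + δ) * ‖c‖ := by gcongr <;> first | exact hQ i | exact hQ' i
    calc ‖σ c i‖ = ‖((ν⁻¹ : 𝔸ˣ) : 𝔸) * (c - (Q i : 𝔸) * c * (((Q i)⁻¹ : 𝔸ˣ) : 𝔸)) * (ν : 𝔸)‖ := rfl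
      _ ≤ ‖((ν⁻¹ : 𝔸ˣ) : 𝔸)‖ * ‖c - (Q i : 𝔸) * c * (((Q i)⁻¹ : 𝔸ˣ) : 𝔸)‖ * ‖(ν : 𝔸)‖ :=
          (norm_mul_le _ _).trans (by gcongr; exact norm_mul_le _ _)
      _ ≤ 2 * ((δ * (1 + δ) + δ) * ‖c‖) * 2 := by gcongr
      _ ≤ 9 * δ * ‖c‖ := by
          have hδ2 : δ * δ ≤ δ * (1 / 200) := mul_le_mul_of_nonneg_left hδ hδ0
          nlinarith [norm_nonneg c, mul_nonneg (mul_nonneg hδ0 hδ0) (norm_nonneg c), mul_nonneg hδ0 (norm_nonneg c)]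
  have hKc : ∀ c, ‖K c‖ ≤ (11 / 20 : ℝ) * ‖c‖ := by
    intro c
    -- split `D(στ) = mean σ · w + R`
    have hR := norm_fderiv_eml_mul_sub_mean_mul_le hτ24 (σ c)
    have hmean : (ν : 𝔸) * (meanCLM ι 𝔸 (σ c) * eml τ) * (((w⁻¹ : 𝔸ˣ) : 𝔸) * ((ν⁻¹ : 𝔸ˣ) : 𝔸))
        = meanCLM ι 𝔸 fun i => c - (Q i : 𝔸) * c * (((Q i)⁻¹ : 𝔸ˣ) : 𝔸) := by
      rw [← hw]
      have : (ν : 𝔸) * (meanCLM ι 𝔸 (σ c) * (w : 𝔸)) * (((w⁻¹ : 𝔸ˣ) : 𝔸) * ((ν⁻¹ : 𝔸ˣ) : 𝔸)) = (ν : 𝔸) * meanCLM ι 𝔸 (σ c) * ((ν⁻¹ : 𝔸ˣ) : 𝔸) := by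
        simp only [mul_assoc, Units.mul_inv_cancel_left]
      rw [this, mul_meanCLM_mul]
      congr 1; funext i
      simp only [hσ, mul_assoc, Units.mul_inv_cancel_left, Units.mul_inv, mul_one]
    have hKsplit : K c = meanCLM ι 𝔸 (fun i => c - (Q i : 𝔸) * c * (((Q i)⁻¹ : 𝔸ˣ) : 𝔸))
        + (ν : 𝔸) * (fderiv ℂ (eml : (ι → 𝔸) → 𝔸) τ (σ c * τ) - meanCLM ι 𝔸 (σ c) * eml τ) * (((w⁻¹ : 𝔸ˣ) : 𝔸) * ((ν⁻¹ : 𝔸ˣ) : 𝔸)) := by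
      rw [← hmean, hK, ContinuousLinearMap.comp_apply, ContinuousLinearMap.comp_apply, ContinuousLinearMap.mulLeftRight_apply, hSgσ]
      noncomm_ring
    rw [hKsplit]
    have hm1 : ‖meanCLM ι 𝔸 (fun i => c - (Q i : 𝔸) * c * (((Q i)⁻¹ : 𝔸ˣ) : 𝔸))‖ ≤ (δ * (1 + δ) + δ) * ‖c‖ := by
      refine (norm_meanCLM_apply_le _).trans ((pi_norm_le_iff_of_nonneg (by positivity)).2 fun i => ?_)
      rw [norm_sub_rev]
      calc ‖(Q i : 𝔸) * c * (((Q i)⁻¹ : 𝔸ˣ) : 𝔸) - c‖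
          ≤ (‖(Q i : 𝔸) - 1‖ * (1 + ‖(((Q i)⁻¹ : 𝔸ˣ) : 𝔸) - 1‖) + ‖(((Q i)⁻¹ : 𝔸ˣ) : 𝔸) - 1‖) * ‖c‖ := norm_conj_sub_self_le (Q i) c
        _ ≤ (δ * (1 + δ) + δ) * ‖c‖ := by gcongr <;> first | exact hQ i | exact hQ' i
    have hm2 : ‖(ν : 𝔸) * (fderiv ℂ (eml : (ι → 𝔸) → 𝔸) τ (σ c * τ) - meanCLM ι 𝔸 (σ c) * eml τ) * (((w⁻¹ : 𝔸ˣ) : 𝔸) * ((ν⁻¹ : 𝔸ˣ) : 𝔸))‖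
        ≤ 2 * (163 * (9 * δ * ‖c‖) * δ) * (2 * 2) := by
      calc _ ≤ ‖(ν : 𝔸)‖ * ‖fderiv ℂ (eml : (ι → 𝔸) → 𝔸) τ (σ c * τ) - meanCLM ι 𝔸 (σ c) * eml τ‖ * ‖((w⁻¹ : 𝔸ˣ) : 𝔸) * ((ν⁻¹ : 𝔸ˣ) : 𝔸)‖ :=
            (norm_mul_le _ _).trans (by gcongr; exact norm_mul_le _ _)
        _ ≤ 2 * (163 * (9 * δ * ‖c‖) * δ) * (2 * 2) := by
            gcongr
            · exact hR.trans (by gcongr; exact hσn c)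
            · exact (norm_mul_le _ _).trans (by gcongr)
    calc _ ≤ ‖meanCLM ι 𝔸 (fun i => c - (Q i : 𝔸) * c * (((Q i)⁻¹ : 𝔸ˣ) : 𝔸))‖
          + ‖(ν : 𝔸) * (fderiv ℂ (eml : (ι → 𝔸) → 𝔸) τ (σ c * τ) - meanCLM ι 𝔸 (σ c) * eml τ) * (((w⁻¹ : 𝔸ˣ) : 𝔸) * ((ν⁻¹ : 𝔸ˣ) : 𝔸))‖ := norm_add_le _ _
      _ ≤ (δ * (1 + δ) + δ) * ‖c‖ + 2 * (163 * (9 * δ * ‖c‖) * δ) * (2 * 2) := by gcongr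
      _ ≤ (11 / 20 : ℝ) * ‖c‖ := by
          have hδ2 : δ * δ ≤ δ * (1 / 200) := mul_le_mul_of_nonneg_left hδ hδ0
          nlinarith [norm_nonneg c, mul_nonneg hδ0 (norm_nonneg c), mul_nonneg (mul_nonneg hδ0 hδ0) (norm_nonneg c),
            mul_le_mul_of_nonneg_right hδ2 (norm_nonneg c), mul_le_mul_of_nonneg_right hδ (norm_nonneg c)]
  -- Neumann
  set T : 𝔸 →L[ℂ] 𝔸 := 1 - K with hT
  have hTn : ‖T - (1 : ℂ) • (1 : 𝔸 →L[ℂ] 𝔸)‖ < ‖(1 : ℂ)‖ := by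
    rw [one_smul, hT, sub_sub_cancel_left, norm_neg, norm_one]
    refine lt_of_le_of_lt (ContinuousLinearMap.opNorm_le_bound _ (by norm_num) hKc) (by norm_num)
  obtain ⟨c, hc⟩ := surjective_of_norm_sub_smul_one_lt hTn m
  refine ⟨c, ?_⟩
  rw [← hKapply c]
  exact hc

/-! ## §3 The tower: top-down construction of the gauge parameter -/

section Tower

open B10Eq27TorusAxialLog (holT gaugeActT gaugeActT_apply transl transl_apply)
open B7Prop1Explicit (expUnit val_expUnit disp)
open Summit.QuantumFields.YangMills.Theorems.Prop8Chart (emlIterU)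
open Summit.QuantumFields.YangMills.Theorems.Prop7SymAvgTwSym (tstairU vframeCovU coe_vframeCovU frameAccU frameAccU_succ frameAccU_zero dbarCovIterU)
open B15DeterminingSets (embIter)
open Summit.QuantumFields.YangMills.Theorems.Prop7AxialGaugeFace (disp_apply_eq_netDisp)
open BlockAveragingEMLLinearised (walkEnd_emb_stairWord_eq_blockSite)

variable {P : Params}

omit [NormedAlgebra ℂ 𝔸] [CompleteSpace 𝔸] [NormOneClass 𝔸] in
/-- the stair end-point of index `i` from the centre `emb y` lies in the block of `y` (✓`walkEnd_emb_stairWord_eq_blockSite`, ✓`Site.blockOf_blockSite`). [cite: Balaban1987RG1, (0.3) p.252] -/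
theorem blockOf_transl_emb_disp_stairWord {j : ℕ} (hj : j + 1 ≤ P.m + P.K) (y : Site P (j + 1)) (i : Idx P) :
    blockOf (transl (emb y) (disp (stairWord i.2.1 (off i.1)))) = y := by
  have h : transl (emb y) (disp (stairWord i.2.1 (off i.1))) = walkEnd (emb y) (stairWord i.2.1 (off i.1)) := by
    funext ν; rw [walkEnd_apply, transl_apply, disp_apply_eq_netDisp]
  rw [h, walkEnd_emb_stairWord_eq_blockSite, Site.blockOf_blockSite hj]

omit [NormedAlgebra ℂ 𝔸] [CompleteSpace 𝔸] [NormOneClass 𝔸] in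
/-- the offset of a fine site inside its block recovers the site (✓`Site.blockEquiv`). [cite: Balaban1987RG1, (0.3) p.252] -/
theorem blockSite_blockOf_offs {j : ℕ} (hj : j + 1 ≤ P.m + P.K) (x : Site P j) :
    Site.blockSite (blockOf x) (fun μ => (⟨(x μ).val % P.L, Nat.mod_lt _ P.L_pos⟩ : Fin P.L)) = x :=
  congrArg Subtype.val ((Site.blockEquiv hj (blockOf x)).symm_apply_apply ⟨x, rfl⟩)

omit [NormedAlgebra ℂ 𝔸] [CompleteSpace 𝔸] [NormOneClass 𝔸] in
/-- the offset of `blockSite y r` is `r`. [cite: Balaban1987RG1, (0.3) p.252] -/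
theorem offs_blockSite {j : ℕ} (hj : j + 1 ≤ P.m + P.K) (y : Site P (j + 1)) (r : Fin P.d → Fin P.L) :
    (fun μ => (⟨((Site.blockSite y r) μ).val % P.L, Nat.mod_lt _ P.L_pos⟩ : Fin P.L)) = r := by
  funext μ; apply Fin.ext
  show ((Site.blockSite y r) μ).val % P.L = (r μ : ℕ)
  rw [Site.val_blockSite hj, Nat.mul_add_mod', Nat.mod_eq_of_lt (r μ).isLt]

omit [NormedAlgebra ℂ 𝔸] [CompleteSpace 𝔸] [NormOneClass 𝔸] in
/-- the offset of the centre `emb y` is the centre offset `(L−1)/2` in every direction. [cite: Balaban1987RG1, (0.3) p.252] -/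
theorem offs_emb {j : ℕ} (hj : j + 1 ≤ P.m + P.K) (y : Site P (j + 1)) :
    (fun μ => (⟨((emb y) μ).val % P.L, Nat.mod_lt _ P.L_pos⟩ : Fin P.L)) = fun _ : Fin P.d => (⟨(P.L - 1) / 2, by have := P.L_pos; omega⟩ : Fin P.L) := by
  funext μ; apply Fin.ext
  show ((emb y) μ).val % P.L = (P.L - 1) / 2
  rw [Site.val_emb hj, Nat.mul_add_mod', Nat.mod_eq_of_lt (by have := P.L_pos; omega)]

omit [NormedAlgebra ℂ 𝔸] [CompleteSpace 𝔸] [NormOneClass 𝔸] in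
/-- the stair end-point of index `i` from the centre is the block site of offset `i.1` (✓`walkEnd_emb_stairWord_eq_blockSite` in `transl`/`disp` letters). [cite: Balaban1987RG1, (0.3) p.252] -/
theorem transl_emb_disp_stairWord_eq_blockSite {j : ℕ} (y : Site P (j + 1)) (i : Idx P) :
    transl (emb y) (disp (stairWord i.2.1 (off i.1))) = Site.blockSite y i.1 := by
  rw [← walkEnd_emb_stairWord_eq_blockSite]
  funext ν; rw [walkEnd_apply, transl_apply, disp_apply_eq_netDisp]

/-- ★★★ **TOP-DOWN CONSTRUCTION OF THE GAUGE PARAMETER** (onto-ness of the frame-corrected operator, all levels below the top `k₀`; gauge-covariant form).  For level-`0` unit fields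
`U₀, U′` whose comparison tower satisfies, at every level `j < k₀` and coarse site `y`: the transporters `τ_j(y) = (tstairU Ū₀⁽ʲ⁾ D̄_j y i)_i` are within `δ` of `1`; the frames `ν_j^{±1}` and
one-level frames `w_j⁻¹` have norm `≤ 2` (unitary data: `= 1`); and the LOOP holonomies **`H_{j,y,i} = Q_{y,i}·Q_{y,(i.1,1,1)}⁻¹·Q_{y,(r_c,1,1)}`** (`Q_{y,i} = ν_j(ŷ)·D̄_j(Γ_{y,i})·ν_j(x_i)⁻¹`, i.e.
`Ū′⁽ʲ⁾` along the stair `i`, back along the reference stair of the same offset, and around the reference loop at the centre — a gauge-INVARIANT closeness, small for regular towers) are within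
`δ ≤ 1/200` of `1` together with their inverses — and for every target `m` on the level-`k` sites (`k ≤ k₀`, `k ≤ m + K`), there is a level-`0` gauge parameter `N` such that along
`U′^{exp(tN)}` the accumulated frames against `U₀` respond with `V` and **`N(x̂⁽ᵏ⁾x) − V(x)·ν_k(x)⁻¹ = m(x)`** at every level-`k` site.  Induction on `k`: at each coarse site the level equation
is solved by `exists_levelMap_eq` with `Q := H`; the lower levels are aimed at the COVARIANTLY block-constant field `x ↦ Ad_{Q_{y,i₀(x)}⁻¹Q_{y,i₀(ŷ)}} c(y)` (reference stair
`i₀(x) = (offset of x, 1, 1)`; the correction is `1` at the centre), and FR₁ §4 (`hasDerivAt_frameAccU_succ_at`) identifies the next-level frame-corrected quantity with the level map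
(`blockOf` and offsets of the centre and of every stair end-point: ✓`Site.blockOf_emb`, ✓`Site.val_emb`, ✓`Site.val_blockSite`). [cite: Balaban1985Averaging, (58) p.27, (97) p.32, (89)-(92) p.31; Balaban1985BackgroundPropagators, (3.19) p.393, (3.21) p.394, (3.114)-(3.115) p.418; Balaban1987RG1, (0.3)-(0.4) pp.252-253] -/
theorem exists_frameCorrected_eq (U₀ U' : GaugeField P 0 𝔸ˣ) (k₀ : ℕ) {δ : ℝ} (hδ0 : 0 ≤ δ) (hδ : δ ≤ 1 / 200)
    (hτ : ∀ (j : ℕ) (y : Site P (j + 1)), j < k₀ → ‖(fun i : Idx P => ((tstairU (emlIterU j U₀) (dbarCovIterU j U₀ U') y i : 𝔸ˣ) : 𝔸)) - 1‖ ≤ δ)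
    (hν : ∀ (j : ℕ) (x : Site P j), j < k₀ → ‖((frameAccU j U₀ U' x : 𝔸ˣ) : 𝔸)‖ ≤ 2)
    (hν' : ∀ (j : ℕ) (x : Site P j), j < k₀ → ‖(((frameAccU j U₀ U' x)⁻¹ : 𝔸ˣ) : 𝔸)‖ ≤ 2)
    (hw : ∀ (j : ℕ) (y : Site P (j + 1)), j < k₀ → ‖(((vframeCovU (emlIterU j U₀) (dbarCovIterU j U₀ U') y)⁻¹ : 𝔸ˣ) : 𝔸)‖ ≤ 2)
    (hH : ∀ (j : ℕ) (y : Site P (j + 1)) (i : Idx P), j < k₀ → ‖((((frameAccU j U₀ U' (emb y) * holT (dbarCovIterU j U₀ U') (emb y) (stairWord i.2.1 (off i.1)) * (frameAccU j U₀ U' (transl (emb y) (disp (stairWord i.2.1 (off i.1)))))⁻¹) * (frameAccU j U₀ U' (emb y) * holT (dbarCovIterU j U₀ U') (emb y) (stairWord (1 : Equiv.Perm (Fin P.d)) (off i.1)) * (frameAccU j U₀ U' (transl (emb y) (disp (stairWord (1 : Equiv.Perm (Fin P.d)) (off i.1)))))⁻¹)⁻¹ * (frameAccU j U₀ U' (emb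 y) * holT (dbarCovIterU j U₀ U') (emb y) (stairWord (1 : Equiv.Perm (Fin P.d)) (off (fun _ : Fin P.d => (⟨(P.L - 1) / 2, by have := P.L_pos; omega⟩ : Fin P.L)))) * (frameAccU j U₀ U' (transl (emb y) (disp (stairWord (1 : Equiv.Perm (Fin P.d)) (off (fun _ : Fin P.d => (⟨(P.L - 1) / 2, by have := P.L_pos; omega⟩ : Fin P.L)))))))⁻¹)) : 𝔸ˣ) : 𝔸) - 1‖ ≤ δ)
    (hH' : ∀ (j : ℕ) (y : Site P (j + 1)) (i : Idx P), j < k₀ → ‖((((frameAccU j U₀ U' (emb y) * holT (dbarCovIterU j U₀ U') (emb y) (stairWord i.2.1 (off i.1)) * (frameAccU j U₀ U' (transl (emb y) (disp (stairWord i.2.1 (off i.1)))))⁻¹) * (frameAccU j U₀ U' (emb y) * holT (dbarCovIterU j U₀ U') (emb y) (stairWord (1 : Equiv.Perm (Fin P.d)) (off i.1)) * (frameAccU j U₀ U' (transl (emb y) (disp (stairWord (1 : Equiv.Perm (Fin P.d)) (off i.1)))))⁻¹)⁻¹ * (frameAccU j U₀ U' (emb y) * holT (dbarCovIterU j U₀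 U') (emb y) (stairWord (1 : Equiv.Perm (Fin P.d)) (off (fun _ : Fin P.d => (⟨(P.L - 1) / 2, by have := P.L_pos; omega⟩ : Fin P.L)))) * (frameAccU j U₀ U' (transl (emb y) (disp (stairWord (1 : Equiv.Perm (Fin P.d)) (off (fun _ : Fin P.d => (⟨(P.L - 1) / 2, by have := P.L_pos; omega⟩ : Fin P.L)))))))⁻¹))⁻¹ : 𝔸ˣ) : 𝔸) - 1‖ ≤ δ) :
    ∀ (k : ℕ), k ≤ k₀ → k ≤ P.m + P.K → ∀ m : Site P k → 𝔸, ∃ (N : Site P 0 → 𝔸) (V : Site P k → 𝔸),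
      (∀ x : Site P k, HasDerivAt (fun t : ℝ => ((frameAccU k U₀ (gaugeActT (fun z : Site P 0 => expUnit (t • N z)) U') x : 𝔸ˣ) : 𝔸)) (V x) 0) ∧
      ∀ x : Site P k, N (embIter k x) - V x * (((frameAccU k U₀ U' x)⁻¹ : 𝔸ˣ) : 𝔸) = m x
  | 0, _, _, m => by
    refine ⟨m, fun _ => 0, fun x => ?_, fun x => ?_⟩
    · have h1 : (fun t : ℝ => ((frameAccU 0 U₀ (gaugeActT (fun z : Site P 0 => expUnit (t • m z)) U') x : 𝔸ˣ) : 𝔸)) = fun _ => 1 := by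
        funext t; rw [frameAccU_zero, Units.val_one]
      rw [h1]; exact hasDerivAt_const 0 1
    · rw [zero_mul, sub_zero]; rfl
  | k + 1, hk₀, hk, m => by
    have hkj : k + 1 ≤ P.m + P.K := hk
    have hjk : k < k₀ := by omega
    -- the gauge family
    have hg0 : ∀ N : Site P 0 → 𝔸, (fun z : Site P 0 => expUnit ((0 : ℝ) • N z)) = fun _ => 1 := fun N => by
      funext z; apply Units.ext; rw [val_expUnit, zero_smul, exp_zero, Units.val_one]
    have hgd : ∀ (N : Site P 0 → 𝔸) (z : Site P 0), HasDerivAt (fun t : ℝ => ((expUnit (t • N z) : 𝔸ˣ) : 𝔸)) (N z) 0 := fun N z => by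
      have h1 := hasDerivAt_exp_smul_const' (𝕂 := ℝ) (N z) (0 : ℝ)
      simp only [zero_smul, exp_zero, mul_one] at h1
      have hfun : (fun t : ℝ => ((expUnit (t • N z) : 𝔸ˣ) : 𝔸)) = fun t => exp (t • N z) := by
        funext t; rw [val_expUnit]
      rw [hfun]; exact h1
    -- letters at level `k`: the conjugating units `Q_{y,i}`, the reference stairs, the correction `R`
    let Q : Site P (k + 1) → Idx P → 𝔸ˣ := fun y i =>
      frameAccU k U₀ U' (emb y) * holT (dbarCovIterU k U₀ U') (emb y) (stairWord i.2.1 (off i.1)) * (frameAccU k U₀ U' (transl (emb y) (disp (stairWord i.2.1 (off i.1)))))⁻¹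
    let rc : Fin P.d → Fin P.L := fun _ => ⟨(P.L - 1) / 2, by have := P.L_pos; omega⟩
    let i₀ : (Fin P.d → Fin P.L) → Idx P := fun r => (r, (1 : Equiv.Perm (Fin P.d)), (1 : Equiv.Perm (Fin P.d)))
    let offs : Site P k → Fin P.d → Fin P.L := fun x μ => ⟨(x μ).val % P.L, Nat.mod_lt _ P.L_pos⟩
    let R : Site P k → 𝔸ˣ := fun x => (Q (blockOf x) (i₀ (offs x)))⁻¹ * Q (blockOf x) (i₀ rc)
    -- solve the level equation at each coarse site, with the loop holonomies `H_i = Q_i·Q_{i₀(i.1)}⁻¹·Q_{i₀(rc)}`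
    have hsolve : ∀ y : Site P (k + 1), ∃ c : 𝔸,
        c - ((frameAccU k U₀ U' (emb y) : 𝔸ˣ) : 𝔸) * fderiv ℂ (eml : (Idx P → 𝔸) → 𝔸)
            (fun i : Idx P => ((tstairU (emlIterU k U₀) (dbarCovIterU k U₀ U') y i : 𝔸ˣ) : 𝔸))
            (fun i : Idx P => (((frameAccU k U₀ U' (emb y))⁻¹ : 𝔸ˣ) : 𝔸) *
                (c - ((Q y i * (Q y (i₀ i.1))⁻¹ * Q y (i₀ rc) : 𝔸ˣ) : 𝔸) * c * (((Q y i * (Q y (i₀ i.1))⁻¹ * Q y (i₀ rc))⁻¹ : 𝔸ˣ) : 𝔸)) *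
                ((frameAccU k U₀ U' (emb y) : 𝔸ˣ) : 𝔸) * ((tstairU (emlIterU k U₀) (dbarCovIterU k U₀ U') y i : 𝔸ˣ) : 𝔸)) *
          (((vframeCovU (emlIterU k U₀) (dbarCovIterU k U₀ U') y)⁻¹ : 𝔸ˣ) : 𝔸) * (((frameAccU k U₀ U' (emb y))⁻¹ : 𝔸ˣ) : 𝔸) = m y :=
      fun y => exists_levelMap_eq _ hδ0 hδ (hτ k y hjk) _ _ (coe_vframeCovU _ _ _) (hν k (emb y) hjk) (hν' k (emb y) hjk) (hw k y hjk)
        (fun i => Q y i * (Q y (i₀ i.1))⁻¹ * Q y (i₀ rc)) (fun i => hH k y i hjk) (fun i => hH' k y i hjk) (m y)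
    choose c hc using hsolve
    -- the lower levels, aimed at the covariantly-block-constant field `x ↦ Ad_{R x} c(blockOf x)`
    obtain ⟨N, V, hF, hρ⟩ := exists_frameCorrected_eq U₀ U' k₀ hδ0 hδ hτ hν hν' hw hH hH' k (by omega) (by omega)
      (fun x => ((R x : 𝔸ˣ) : 𝔸) * c (blockOf x) * (((R x)⁻¹ : 𝔸ˣ) : 𝔸))
    refine ⟨N, fun y => V (emb y) * ((vframeCovU (emlIterU k U₀) (dbarCovIterU k U₀ U') y : 𝔸ˣ) : 𝔸) +
        ((frameAccU k U₀ U' (emb y) : 𝔸ˣ) : 𝔸) *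
          fderiv ℂ (eml : (Idx P → 𝔸) → 𝔸) (fun i : Idx P => ((tstairU (emlIterU k U₀) (dbarCovIterU k U₀ U') y i : 𝔸ˣ) : 𝔸))
            (fun i : Idx P =>
              ((((frameAccU k U₀ U' (emb y))⁻¹ : 𝔸ˣ) : 𝔸) * (N (embIter k (emb y)) - V (emb y) * (((frameAccU k U₀ U' (emb y))⁻¹ : 𝔸ˣ) : 𝔸)) *
                    ((frameAccU k U₀ U' (emb y) : 𝔸ˣ) : 𝔸) -
                  ((holT (dbarCovIterU k U₀ U') (emb y) (stairWord i.2.1 (off i.1)) : 𝔸ˣ) : 𝔸) *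
                      ((((frameAccU k U₀ U' (transl (emb y) (disp (stairWord i.2.1 (off i.1)))))⁻¹ : 𝔸ˣ) : 𝔸) *
                          (N (embIter k (transl (emb y) (disp (stairWord i.2.1 (off i.1))))) -
                            V (transl (emb y) (disp (stairWord i.2.1 (off i.1)))) *
                              (((frameAccU k U₀ U' (transl (emb y) (disp (stairWord i.2.1 (off i.1)))))⁻¹ : 𝔸ˣ) : 𝔸)) *
                        ((frameAccU k U₀ U' (transl (emb y) (disp (stairWord i.2.1 (off i.1)))) : 𝔸ˣ) : 𝔸)) *
                    (((holT (dbarCovIterU k U₀ U') (emb y) (stairWord i.2.1 (off i.1)))⁻¹ : 𝔸ˣ) : 𝔸)) *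
                ((tstairU (emlIterU k U₀) (dbarCovIterU k U₀ U') y i : 𝔸ˣ) : 𝔸)), fun y => ?_, fun y => ?_⟩
    · exact hasDerivAt_frameAccU_succ_at U₀ U' (hg0 N) (hgd N) k hF y ((hτ k y hjk).trans_lt (hδ.trans_lt (by norm_num)))
    · -- the algebra: `ρ_{k+1}(y) = L_{k,y}(c(y)) = m(y)`
      have hcy := hc y
      -- the correction at the centre is `1`, at the stair end-points it is `Q_{i₀(i.1)}⁻¹Q_{i₀(rc)}`
      have hRc : R (emb y) = 1 := by
        show (Q (blockOf (emb y)) (i₀ (offs (emb y))))⁻¹ * Q (blockOf (emb y)) (i₀ rc) = 1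
        have h1 : offs (emb y) = rc := offs_emb hkj y
        rw [h1, Site.blockOf_emb hkj, inv_mul_cancel]
      have hRi : ∀ i : Idx P, R (transl (emb y) (disp (stairWord i.2.1 (off i.1)))) = (Q y (i₀ i.1))⁻¹ * Q y (i₀ rc) := by
        intro i
        show (Q (blockOf (transl (emb y) (disp (stairWord i.2.1 (off i.1))))) (i₀ (offs (transl (emb y) (disp (stairWord i.2.1 (off i.1)))))))⁻¹ *
            Q (blockOf (transl (emb y) (disp (stairWord i.2.1 (off i.1))))) (i₀ rc) = (Q y (i₀ i.1))⁻¹ * Q y (i₀ rc)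
        have h1 : offs (transl (emb y) (disp (stairWord i.2.1 (off i.1)))) = i.1 := by
          show (fun μ => (⟨((transl (emb y) (disp (stairWord i.2.1 (off i.1)))) μ).val % P.L, Nat.mod_lt _ P.L_pos⟩ : Fin P.L)) = i.1
          rw [transl_emb_disp_stairWord_eq_blockSite]; exact offs_blockSite hkj y i.1
        rw [h1, blockOf_transl_emb_disp_stairWord hkj y i]
      have hρ1 : N (embIter k (emb y)) - V (emb y) * (((frameAccU k U₀ U' (emb y))⁻¹ : 𝔸ˣ) : 𝔸) = c y := by
        rw [hρ (emb y), hRc, Site.blockOf_emb hkj, inv_one, Units.val_one, one_mul, mul_one]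
      have hρ2 : ∀ i : Idx P, N (embIter k (transl (emb y) (disp (stairWord i.2.1 (off i.1))))) -
          V (transl (emb y) (disp (stairWord i.2.1 (off i.1)))) * (((frameAccU k U₀ U' (transl (emb y) (disp (stairWord i.2.1 (off i.1)))))⁻¹ : 𝔸ˣ) : 𝔸)
            = (((Q y (i₀ i.1))⁻¹ * Q y (i₀ rc) : 𝔸ˣ) : 𝔸) * c y * ((((Q y (i₀ i.1))⁻¹ * Q y (i₀ rc))⁻¹ : 𝔸ˣ) : 𝔸) := by
        intro i; rw [hρ, hRi i, blockOf_transl_emb_disp_stairWord hkj y i]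
      have hN : N (embIter k (emb y)) = c y + V (emb y) * (((frameAccU k U₀ U' (emb y))⁻¹ : 𝔸ˣ) : 𝔸) := by
        rw [← hρ1, sub_add_cancel]
      have key : ∀ D : 𝔸, N (embIter k (emb y)) - (V (emb y) * ((vframeCovU (emlIterU k U₀) (dbarCovIterU k U₀ U') y : 𝔸ˣ) : 𝔸)
            + ((frameAccU k U₀ U' (emb y) : 𝔸ˣ) : 𝔸) * D) *
            (((frameAccU k U₀ U' (emb y) * vframeCovU (emlIterU k U₀) (dbarCovIterU k U₀ U') y)⁻¹ : 𝔸ˣ) : 𝔸)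
          = c y - ((frameAccU k U₀ U' (emb y) : 𝔸ˣ) : 𝔸) * D * (((vframeCovU (emlIterU k U₀) (dbarCovIterU k U₀ U') y)⁻¹ : 𝔸ˣ) : 𝔸) *
              (((frameAccU k U₀ U' (emb y))⁻¹ : 𝔸ˣ) : 𝔸) := by
        intro D
        rw [hN, mul_inv_rev, Units.val_mul]
        simp only [add_mul, mul_assoc, Units.mul_inv_cancel_left]
        abel
      rw [← hcy]
      simp only [hρ1, hρ2]
      rw [show embIter (k + 1) y = embIter k (emb y) from rfl, frameAccU_succ, key]
      refine congrArg (fun D : 𝔸 => c y - ((frameAccU k U₀ U' (emb y) : 𝔸ˣ) : 𝔸) * D *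
          (((vframeCovU (emlIterU k U₀) (dbarCovIterU k U₀ U') y)⁻¹ : 𝔸ˣ) : 𝔸) * (((frameAccU k U₀ U' (emb y))⁻¹ : 𝔸ˣ) : 𝔸))
        (congrArg (fun f : Idx P → 𝔸 => fderiv ℂ (eml : (Idx P → 𝔸) → 𝔸)
          (fun i : Idx P => ((tstairU (emlIterU k U₀) (dbarCovIterU k U₀ U') y i : 𝔸ˣ) : 𝔸)) f) (funext fun i => ?_))
      simp only [Q, mul_inv_rev, inv_inv, Units.val_mul, mul_assoc, mul_sub, sub_mul, Units.inv_mul_cancel_left]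

end Tower


end Summit.QuantumFields.YangMills.Theorems.Prop7FrameLevelOnto

end
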